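import Literature.Computability.Complexity.ScaledKannanDiagonal
import Literature.Computability.Complexity.MurrayWilliams2018HeadlineQP
import Literature.Computability.Complexity.ArthurMerlinGamesProofs
import Literature.Computability.Complexity.CodeFPArith
import Literature.Computability.Complexity.PlumbingBricks
import HarnessLib

/-!
# Murray–Williams 2018, Theorem 3.1: the Merlin–Arthur protocol `M₁` and its referee —
# Theorem 3.1 (universal-referee form) from a same-length checkable complete language

Literature / circuit complexity. C. D. Murray, R. R. Williams, *Circuit lower bounds for
nondeterministic quasi-polytime: an easy witness lemma for NP and NQP*, STOC 2018 (ECCC TR17-188),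
§3. The cone of the headline `MurrayWilliams2018_NQP_not_subset_ACC0 : ¬ (NQP ⊆ ACC0)`
(`CircuitLowerBounds.lean`) had been reduced to Theorem 3.1 in universal-referee form (`h31` of
`MurrayWilliams2018EasyWitnessAssembly.lean`; consumed by
`MurrayWilliams2018_lemma_4_1_ae_of_thm_3_1_universal_of_umansGenerator` and by
`MurrayWilliams2018_NQP_not_subset_ACC0_of_thm_3_1_universal_of_qsimulation`), whose HARDNESS half is
a theorem (`AlmostAE.eventually_lt_circuitSize_hardLang_or`, `MurrayWilliams2018HardLanguage.lean`,
with Thm. 2.3 by `KannanScaled.eventually_lt_circuitSize_diag` and Claim 1 by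
`KannanScaled.exists_reduction_of_isHard`, `ScaledKannanDiagonal.lean`) and whose UPPER-BOUND half —
the Merlin–Arthur protocol `M₁` itself ("MA Promise and Running Time Analysis", ECCC p. 10) — was
the residual obligation (`hprot` of `h31_of_hardLang_protocol_kannanScaled`). This file PROVES the
upper-bound half for every language `Lstar` with the four properties of Murray–Williams' Theorem 2.2
(`PSPACE`-hard, paddable, downward self-reducible, same-length checkable; Santhanam 2007 over
Trevisan–Vadhan), given as hypotheses, and so reduces Theorem 3.1 — hence Lemma 4.1 and the headline —
to the EXISTENCE of such a language (Thm. 2.2) alone: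

* `AlmostAE.SameLengthChecker Lstar` — the checkability clause of Thm. 2.2 over the tree (see below);
* `MWProtocol.Ref g c lang` — **the referee of `M₁`** as a language on the game strings
  `⟨⟨y, advice⟩, enc [Merlin's move, Arthur's coins]⟩` of the tree's Arthur–Merlin games
  (`ArthurMerlinGames.lean`, `AdvisedMAGame` of `MurrayWilliams2018EasyWitnessAssembly.lean`), over the
  reduction `g` of Claim 1, the checker's coin polynomial `c` and verdict language `lang`: read the
  advice `⟨flag, αₙ, s₂(n), N(n)⟩` (`advCode`); if `αₙ = s₂(n)` let `z = g (pad (N n) y)` and query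
  `1^{s₂(n)-|z|} z`, else parse `y = 1ᵃ0x` (`stripOnes`), reject if `|x| + 1 > αₙ`, and query
  `1^{αₙ-|x|-1} 0x`; accept iff the checker accepts `⟨⟨query, coins ↾ c(|query|)⟩, d⟩`, `d` the first
  component of Merlin's move ("Merlin provides a circuit `C` and Arthur runs `M^C`");
  **`MWProtocol.Ref_mem_P`**: the referee is polynomial time (typed `CodeFP` combinators over the
  brick algebra; `stripOnes` is a two-state transduction);
* `MWProtocol.GoodLen`, `goodAdv`, `goodLang` — the pointwise inequalities under which the protocol
  is playable at a length (all eventual consequences of the constraints (i)–(iii),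
  `eventually_goodLen`), the advice (`⟨1, αₙ, s₂ n, N n⟩` on good lengths, `⟨0,0,0,0⟩` on the
  finitely many bad ones, where the referee rejects) and the language decided,
  `L₁ = hardLang ∩ {good lengths}`;
* **`MWProtocol.advisedMAGame_goodLang`** — the MA promise on ALL inputs: completeness by Merlin
  playing a shortest correct description of the slice of `Lstar` at the query length (it exists and
  is short by the advice, `AlmostAE.circuitSize_advice_le`, `AlmostAE.exists_describesSlice`, and the
  checker accepts it with probability `1`), soundness by the checker's soundness against every
  description (the winning coin strings are the cylinder over the checker's bad coins,
  `uniformProb_take_of_le`), rejection on unplayable inputs, which are not in `L₁`;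
* **`MWProtocol.h31_of_sameLengthChecker`** — Theorem 3.1 in universal-referee form (ONE referee and
  ONE exponent `D` before `s, s₁, s₂`; advice `≤ D (log₂ s₂(n) + 1)`; the hardness disjunction
  transferred from `hardLang` to `L₁` by `AlmostAE.circuitSize_eq_of_forall_iff` on good lengths);
* consequences: `MurrayWilliams2018_lemma_4_1_ae_of_sameLengthChecker_of_umansGenerator`,
  `MurrayWilliams2018_NQP_not_subset_ACC0_of_sameLengthChecker_of_umansGenerator`,
  **`MurrayWilliams2018_NQP_not_subset_ACC0_of_sameLengthChecker_of_qsimulation`** (headline from a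
  Thm-2.2 language and the polylogarithmic-seed advice simulation `hsimQ` of
  `MurrayWilliams2018HeadlineQP.lean`).

## The checkability clause over the tree (faithfulness)

Printed (Thm. 2.2, ECCC p. 9): "a probabilistic polynomial-time oracle Turing machine `M` so that,
for any input `x`, (1) `M` asks its oracle queries only of length `|x|`; (2) if `M` is given
`L_PSPACE` as oracle and `x ∈ L_PSPACE`, then `M` accepts with probability `1`; (3) if
`x ∉ L_PSPACE`, then irrespective of the oracle given to `M`, `M` rejects with probability at least
`2/3`." In the protocol the oracle IS Merlin's circuit, a string: as for the tree's downward
self-reduction (`AlmostAE.DSR`, `MurrayWilliams2018DSR.lean`) the oracle is rendered as a circuit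
description `d` answered by the evaluator `CircEval.evalFn ⟨q, d⟩`, the coins as a uniform string
`r ∈ {0,1}^{coins(|x|)}`, and `M` as a language `lang ∈ P` on `⟨⟨x, r⟩, d⟩`. Clause (2) with (1) is
rendered: for EVERY `d` describing the slice of `L` at length `|x|` (`AlmostAE.DescribesSlice`,
whatever `d` answers elsewhere) and every `x ∈ L`, all coin strings accept; clause (3): for `x ∉ L`
and EVERY string `d`, the accepting coins have `uniformProb ≤ 1/3`. A printed checker `M` yields such
a `lang` (run `M` with oracle `q ↦ evalFn ⟨q, d⟩`: by (1) completeness only sees the slice `d`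
describes; (3) holds against every oracle, in particular this one), so the tree's notion asks no
more than the source; every slice has a description (`AlmostAE.exists_describesSlice`), so it is not
vacuous. The thresholds `1` / `1/3` are the printed ones.

## Design notes

* The referee is universal: `s, s₁, s₂` are not known to it, so `αₙ`, `s₂(n)` and the scale
  `N(n) = 10(s(n)+2)` of `KannanScaled.diag` travel in the advice (`13 (log₂ s₂ n + 1)` bits on good
  lengths, `advCode`, `length_advCode_le`), within the printed `O(log s₂(n))`.
* `AdvisedMAGame` asks the promise on ALL inputs while the constraints (i)–(iii) of the universal
  form hold eventually; on the finitely many lengths where they fail the advice flag makes the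
  referee reject and `L₁` is declared empty there (`goodLang`) — a finite modification of
  `hardLang`, invisible to the eventual hardness disjunction.
* Unary paddings are produced under the unary budget `|r|` (Arthur's move), binary-to-unary
  conversion being capped (`CodeFP.unOfNatMin`); on good lengths the caps are inactive
  (`GoodLen.s₂_le`).
* Nothing is asserted: `SameLengthChecker`, `DSR`, `IsHard PSPACE Lstar`, paddability and the
  absence of all-ones words are hypotheses/structures; no named fact is introduced (D-0026). What
  remains for the headline along this line: a language with these properties (Thm. 2.2: Santhanam,
  SIAM J. Comput. 39 (2009), Lemma 11 ff. over Trevisan–Vadhan's `IP = PSPACE`-language, TV07 §4 —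
  whose arithmetization operators are in `QBFArithmetization.lean`) and `hsimQ`.

## References

* C. D. Murray, R. R. Williams, *Circuit lower bounds for nondeterministic quasi-polytime: an easy
  witness lemma for NP and NQP*, STOC 2018, 890–901 (ECCC TR17-188), Thm. 2.2, Thm. 2.3, §3: Claim 1,
  displays (1)–(2), the protocol `M₁`, "MA Promise and Running Time Analysis" (ECCC pp. 9–11), Thm. 3.1,
  Lemma 4.1, §1.1 [MurrayWilliams2018] (held: `paper:doi-10-1145-3188745-3188910`, pp. 9–11 re-read
  2026-08-15).
* R. Santhanam, *Circuit lower bounds for Merlin–Arthur classes*, SIAM J. Comput. 39 (2009) 1038–1061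
  (STOC 2007) — the checkable `PSPACE`-complete language (cited through MW Thm. 2.2).
* L. Trevisan, S. Vadhan, *Pseudorandomness and average-case complexity via uniform reductions*,
  Comput. Complexity 16 (2007) 331–364, §4 [TrevisanVadhan2007].
* L. Babai, S. Moran, *Arthur–Merlin games: a randomized proof system, and a hierarchy of complexity
  classes*, JCSS 36 (1988), §2.3 (game values) [BabaiMoran1988].
* S. Arora, B. Barak, *Computational Complexity: A Modern Approach*, CUP 2009, §1.3 (polynomial time),
  Thm. 6.18 (circuit evaluation), Def. 8.10 (`MA`) [AroraBarakCC2009].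
-/

noncomputable section

namespace Literature.Computability.Complexity

open _root_.Computability Polynomial Brick CircEval CodeFP

namespace AlmostAE

/-- **Same-length checkability** (Murray–Williams 2018, Thm. 2.2, after Santhanam 2007 and
Trevisan–Vadhan: "there is a probabilistic polynomial-time oracle Turing machine `M` so that, for
any input `x`, (1) `M` asks its oracle queries only of length `|x|`, (2) if `M` is given `L` as
oracle and `x ∈ L` then `M` accepts with probability `1`, (3) if `x ∉ L` then irrespective of the
oracle `M` rejects with probability at least `2/3`"), over the tree and in the form the protocol
`M₁` of Thm. 3.1 consumes it ("Merlin provides a circuit `C` and Arthur runs `M^C`"): the oracle is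
a circuit DESCRIPTION `d`, read by the evaluator `CircEval.evalFn ⟨q, d⟩` (as in `DSR`), Arthur's
coins are a string `r` of length `coins |x|`, and the machine is a polynomial-time language `lang`
on the triples `⟨⟨x, r⟩, d⟩`. Clause (1) is rendered semantically, as all the protocol needs:
completeness (2) is required for EVERY `d` describing the slice of `L` at length `|x|`
(`DescribesSlice`, whatever `d` answers at other lengths); soundness (3) holds against every `d`.
[cite: MurrayWilliams2018, Thm. 2.2] -/
structure SameLengthChecker (L : Language Bool) where
  /-- Arthur's verdict on `⟨⟨x, r⟩, d⟩`: input, coins, oracle description -/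
  lang : Language Bool
  /-- it is polynomial time -/
  mem_P : lang ∈ Classes.P
  /-- the number of coins on inputs of length `n` -/
  coins : Polynomial ℕ
  /-- perfect completeness with every correct same-length oracle -/
  complete : ∀ (ℓ : ℕ) (d : List Bool), DescribesSlice L ℓ d →
    ∀ x ∈ L, x.length = ℓ → ∀ r : List Bool, r.length = coins.eval ℓ →
      boolPair (boolPair x r) d ∈ lang
  /-- soundness `1/3` against every oracle -/
  sound : ∀ x ∉ L, ∀ d : List Bool,
    uniformProb (coins.eval x.length) {r | boolPair (boolPair x r) d ∈ lang} ≤ 1 / 3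

end AlmostAE

namespace MWProtocol

/-! ### Stripping the front padding `1ᵃ` -/

/-- Strip the leading `1`s: `stripOnes (1ᵃ 0 x) = 0 x`, `stripOnes 1ᵃ = ε` (the protocol's
"parse `y = 1ᵃ0x`"). [cite: MurrayWilliams2018, Thm. 3.1 (the protocol M₁)] -/
def stripOnes : List Bool → List Bool
  | [] => []
  | true :: t => stripOnes t
  | false :: t => false :: t

/-- `stripOnes (1ᵃ ++ 0 :: x) = 0 :: x`. [folklore] -/
@[simp] theorem stripOnes_replicate_append (a : ℕ) (x : List Bool) :
    stripOnes (List.replicate a true ++ false :: x) = false :: x := by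
  induction a with
  | zero => rfl
  | succ a ih => simpa only [List.replicate_succ, List.cons_append, stripOnes] using ih

/-- `stripOnes 1ᵃ = ε`. [folklore] -/
@[simp] theorem stripOnes_replicate (a : ℕ) : stripOnes (List.replicate a true) = [] := by
  induction a with
  | zero => rfl
  | succ a ih => simpa only [List.replicate_succ, stripOnes] using ih

/-- Every word is `1ᵃ` or `1ᵃ 0 x`, and `stripOnes` tells which. [folklore] -/
theorem eq_replicate_or_exists (y : List Bool) :
    (y = List.replicate y.length true ∧ stripOnes y = []) ∨
      ∃ (a : ℕ) (x : List Bool), y = List.replicate a true ++ false :: x ∧ stripOnes y = false :: x := by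
  induction y with
  | nil => exact Or.inl ⟨rfl, rfl⟩
  | cons b t ih =>
    cases b
    · exact Or.inr ⟨0, t, rfl, rfl⟩
    · rcases ih with ⟨ht, hs⟩ | ⟨a, x, ht, hs⟩
      · refine Or.inl ⟨?_, by simpa only [stripOnes] using hs⟩
        rw [List.length_cons, List.replicate_succ]
        exact congrArg _ ht
      · exact Or.inr ⟨a + 1, x, by rw [ht]; rfl, by simpa only [stripOnes] using hs⟩

/-- The two-state transducer computing `stripOnes`: state `false` = skipping the leading `1`s
(the first `0` is emitted and switches the state), state `true` = copying. [folklore] -/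
def stripOnesT : FST Bool Bool Bool where
  init := false
  step s b := if s then (true, [b]) else if b then (false, []) else (true, [false])
  front _ := []
  keep _ := true

/-- Transition in the copying state. [folklore] -/
@[simp] theorem stripOnesT_step_true (b : Bool) : stripOnesT.step true b = (true, [b]) := rfl

/-- Transition in the skipping state on a `1`: skip. [folklore] -/
@[simp] theorem stripOnesT_step_false_true : stripOnesT.step false true = (false, []) := rfl

/-- Transition in the skipping state on a `0`: emit it and copy from now on. [folklore] -/
@[simp] theorem stripOnesT_step_false_false : stripOnesT.step false false = (true, [false]) := rfl

/-- The run of `stripOnesT` in the copying state is the identity. [folklore] -/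
theorem stripOnesT_run_true (t : List Bool) : stripOnesT.run true t = (true, t) := by
  induction t with
  | nil => rfl
  | cons b t ih => simp [FST.run_cons, ih]

/-- The run of `stripOnesT` from the skipping state emits `stripOnes t`. [folklore] -/
theorem stripOnesT_run_false (t : List Bool) : (stripOnesT.run false t).2 = stripOnes t := by
  induction t with
  | nil => rfl
  | cons b t ih =>
    cases b
    · simp [FST.run_cons, stripOnes, stripOnesT_run_true]
    · simpa [FST.run_cons, stripOnes] using ih

/-- `stripOnesT` computes `stripOnes`. [folklore] -/
theorem stripOnesT_eval : stripOnesT.eval = stripOnes := by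
  funext t
  simp [FST.eval, stripOnesT_run_false, show stripOnesT.init = false from rfl,
    show ∀ s, stripOnesT.keep s = true from fun _ => rfl, show ∀ s, stripOnesT.front s = [] from fun _ => rfl]

/-- **`stripOnes ∈ FP`** (a finite-state transduction). [folklore] -/
theorem stripOnes_mem_FP : stripOnes ∈ FP := by
  rw [← stripOnesT_eval]; exact stripOnesT.polyTimeComputable_eval

/-- `stripOnes` on codes. [folklore] -/
theorem stripOnesC : CodeFP strE strE stripOnes := of_fn stripOnes stripOnes_mem_FP fun _ => rfl

/-! ### The advice code -/

/-- **The advice string** of the protocol at one length: a flag (is the length good?), `αₙ`,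
`s₂(n)` and the scale `N(n) = 10(s(n)+2)` of the diagonal language, in binary:
`⟨[flag], ⟨bin α, ⟨bin S, bin N⟩⟩⟩` ("`αₙ` can be encoded in at most `2 log s₂(n)` bits … if it is
`s₂(n)`, then no further information is required, as that can be computed by the machine" — here the
referee is universal, fixed before `s, s₁, s₂`, so `s₂(n)` and `N(n)` travel in the advice too).
[cite: MurrayWilliams2018, Thm. 3.1 (display (2))] -/
def advCode (b : Bool) (α S N : ℕ) : List Bool :=
  boolPair [b] (boolPair (natE α) (boolPair (natE S) (natE N)))

/-- `|bin n| ≤ log₂ n + 1`. [folklore] -/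
theorem length_natE_le_log (n : ℕ) : (natE n).length ≤ Nat.log 2 n + 1 := by
  rw [show (natE n).length = Nat.size n from TM2Pass.length_encodeNat_eq_size n]
  exact Nat.size_le.2 (Nat.lt_pow_succ_log_self one_lt_two n)

/-- **Length of the advice**: `|advCode b α S N| = 8 + 2|bin α| + 2|bin S| + |bin N|`. [folklore] -/
theorem length_advCode (b : Bool) (α S N : ℕ) :
    (advCode b α S N).length = 8 + 2 * (natE α).length + 2 * (natE S).length + (natE N).length := by
  simp only [advCode, length_boolPair, List.length_singleton]
  ring

/-- The advice has `≤ 13 (log₂ S + 1)` bits when `α, N ≤ S`. [cite: MurrayWilliams2018, Thm. 3.1 ("αₙ can be encoded in at most 2 log s₂(n) bits")] -/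
theorem length_advCode_le {b : Bool} {α S N : ℕ} (hα : α ≤ S) (hN : N ≤ S) :
    (advCode b α S N).length ≤ 13 * (Nat.log 2 S + 1) := by
  rw [length_advCode]
  have h1 := (length_natE_le_log α).trans (Nat.succ_le_succ (Nat.log_mono_right hα))
  have h2 := length_natE_le_log S
  have h3 := (length_natE_le_log N).trans (Nat.succ_le_succ (Nat.log_mono_right hN))
  omega

/-- The trivial advice of a bad length has `8` bits. [folklore] -/
theorem length_advCode_false : (advCode false 0 0 0).length = 8 := by
  rw [length_advCode]; rfl

/-! ### The referee: behaviour -/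

section Behaviour

variable (g : List Bool → List Bool) (c : Polynomial ℕ)

/-- The input word `y` of a referee string `⟨⟨y, adv⟩, moves⟩`. [folklore] -/
def yOf (z : List Bool) : List Bool := fstF (fstF z)
/-- The advice of a referee string. [folklore] -/
def advOf (z : List Bool) : List Bool := sndF (fstF z)
/-- The flag of the advice: is this length good? [folklore] -/
def flagOf (z : List Bool) : Bool := decide (fstF (advOf z) = [true])
/-- `αₙ`, read off the advice. [cite: MurrayWilliams2018, Thm. 3.1 (display (2))] -/
def alphaOf (z : List Bool) : ℕ := bitsToNat (fstF (sndF (advOf z)))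
/-- `s₂(n)`, read off the advice. [folklore] -/
def s2Of (z : List Bool) : ℕ := bitsToNat (fstF (sndF (sndF (advOf z))))
/-- The scale `N(n)` of the diagonal language, read off the advice. [folklore] -/
def scaleOf (z : List Bool) : ℕ := bitsToNat (sndF (sndF (sndF (advOf z))))
/-- Arthur's coin string (the second move). [folklore] -/
def coinsOf (z : List Bool) : List Bool := fstF (sndF (sndF (sndF z)))
/-- Merlin's circuit description: the first component of the first move. [cite: MurrayWilliams2018, Thm. 3.1 ("Guess an … circuit C of size s₁(n)")] -/
def descOf (z : List Bool) : List Bool := fstF (fstF (sndF (sndF z)))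
/-- The unary budget available for paddings: the length of Arthur's move. [folklore] -/
def capOf (z : List Bool) : ℕ := (coinsOf z).length

/-- Branch `αₙ = s₂(n)`: the padded input `pad (N n) y = y 0^{N(n)-n}` of the diagonal language
(padding capped by the budget). [cite: MurrayWilliams2018, Thm. 3.1 ("Let z = R(y)")] -/
def padY (z : List Bool) : List Bool :=
  yOf z ++ List.replicate (min (scaleOf z - (yOf z).length) (capOf z)) false

/-- Branch `αₙ = s₂(n)`: `z = R(y) = g (pad (N n) y)`. [cite: MurrayWilliams2018, Thm. 3.1 and Claim 1] -/
def zA (z : List Bool) : List Bool := g (padY z)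

/-- Branch `αₙ = s₂(n)` is playable: `|z| ≤ s₂(n)` ("note `|z| ≤ s₂(n)` (by constraint (i))").
[cite: MurrayWilliams2018, Thm. 3.1 (the protocol M₁)] -/
def okA (z : List Bool) : Bool := decide ((zA g z).length ≤ s2Of z)

/-- Branch `αₙ = s₂(n)`: the query `1^{s₂(n)-|z|} z` to Merlin's circuit.
[cite: MurrayWilliams2018, Thm. 3.1 ("Output M^C(1^{s₂(n)-|z|} z)")] -/
def qA (z : List Bool) : List Bool :=
  List.replicate (min (s2Of z - (zA g z).length) (capOf z)) true ++ zA g z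

/-- Branch `αₙ < s₂(n)`: the payload `x` of `y = 1ᵃ 0 x`. [cite: MurrayWilliams2018, Thm. 3.1 ("Parse y = 1ᵃ0x")] -/
def xB (z : List Bool) : List Bool := (stripOnes (yOf z)).drop 1

/-- Branch `αₙ < s₂(n)` is playable: `y` has a `0` and `|x| + 1 ≤ αₙ` ("If `|x| + 1 > αₙ` then
reject"). [cite: MurrayWilliams2018, Thm. 3.1 (the protocol M₁)] -/
def okB (z : List Bool) : Bool :=
  (!decide ((stripOnes (yOf z)).length = 0)) && decide ((xB z).length + 1 ≤ alphaOf z)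

/-- Branch `αₙ < s₂(n)`: the query `1^{αₙ-|x|-1} 0 x`. [cite: MurrayWilliams2018, Thm. 3.1 ("Output M^C(1^{αₙ-|x|-1} 0x)")] -/
def qB (z : List Bool) : List Bool :=
  List.replicate (min (alphaOf z - ((xB z).length + 1)) (capOf z)) true ++ false :: xB z

/-- Which branch: `αₙ = s₂(n)`? [cite: MurrayWilliams2018, Thm. 3.1 ("If αₙ = s₂(n)")] -/
def isA (z : List Bool) : Bool := decide (alphaOf z = s2Of z)

/-- The referee plays (does not reject outright): good length and a playable branch. [cite: MurrayWilliams2018, Thm. 3.1 (the protocol M₁)] -/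
def okOf (z : List Bool) : Bool := flagOf z && (if isA z then okA g z else okB z)

/-- The query handed to the checker. [cite: MurrayWilliams2018, Thm. 3.1 (the protocol M₁)] -/
def queryOf (z : List Bool) : List Bool := if isA z then qA g z else qB z

/-- The checker's input `⟨⟨q, r ↾ coins(|q|)⟩, d⟩`: the query, Arthur's coins cut to the checker's
coin length, Merlin's description ("Arthur runs `M^C`"). [cite: MurrayWilliams2018, Thm. 3.1 (the protocol M₁)] -/
def tripleOf (z : List Bool) : List Bool :=
  boolPair (boolPair (queryOf g z) ((coinsOf z).take (c.eval (queryOf g z).length))) (descOf z)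

/-- **The referee of the protocol `M₁`** over the reduction `g` (Claim 1), the coin polynomial `c`
and the verdict language `lang` of the checker: accept iff the length is good, the branch is
playable, and the checker accepts `⟨⟨q, r ↾ coins(|q|)⟩, d⟩`. [cite: MurrayWilliams2018, Thm. 3.1 (the protocol M₁)] -/
def Ref (lang : Language Bool) : Language Bool :=
  {z | okOf g z = true ∧ tripleOf g c z ∈ lang}

/-- Unfolding membership in `Ref` (definitional). [folklore] -/
theorem mem_Ref_iff (lang : Language Bool) (z : List Bool) :
    z ∈ Ref g c lang ↔ okOf g z = true ∧ tripleOf g c z ∈ lang :=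
  Iff.rfl

/-! ### The referee on game strings -/

variable (y a hdr mv r tl : List Bool)

/-- Reading `y`. [folklore] -/
@[simp] theorem yOf_game : yOf (boolPair (boolPair y a) (boolPair hdr (boolPair mv (boolPair r tl)))) = y := by
  simp [yOf]
/-- Reading the advice. [folklore] -/
@[simp] theorem advOf_game : advOf (boolPair (boolPair y a) (boolPair hdr (boolPair mv (boolPair r tl)))) = a := by
  simp [advOf]
/-- Reading the coins. [folklore] -/
@[simp] theorem coinsOf_game : coinsOf (boolPair (boolPair y a) (boolPair hdr (boolPair mv (boolPair r tl)))) = r := by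
  simp [coinsOf]
/-- Reading the description. [folklore] -/
@[simp] theorem descOf_game : descOf (boolPair (boolPair y a) (boolPair hdr (boolPair mv (boolPair r tl)))) = fstF mv := by
  simp [descOf]

variable (b : Bool) (α S N : ℕ)

/-- Reading the flag. [folklore] -/
@[simp] theorem flagOf_game :
    flagOf (boolPair (boolPair y (advCode b α S N)) (boolPair hdr (boolPair mv (boolPair r tl)))) = b := by
  cases b <;> simp [flagOf, advCode]
/-- Reading `αₙ`. [folklore] -/
@[simp] theorem alphaOf_game :
    alphaOf (boolPair (boolPair y (advCode b α S N)) (boolPair hdr (boolPair mv (boolPair r tl)))) = α := by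
  simp [alphaOf, advCode]
/-- Reading `s₂(n)`. [folklore] -/
@[simp] theorem s2Of_game :
    s2Of (boolPair (boolPair y (advCode b α S N)) (boolPair hdr (boolPair mv (boolPair r tl)))) = S := by
  simp [s2Of, advCode]
/-- Reading `N(n)`. [folklore] -/
@[simp] theorem scaleOf_game :
    scaleOf (boolPair (boolPair y (advCode b α S N)) (boolPair hdr (boolPair mv (boolPair r tl)))) = N := by
  simp [scaleOf, advCode]

end Behaviour

/-! ### The referee is polynomial time -/

section PolyTime

variable {g : List Bool → List Bool} (hg : g ∈ FP) (c : Polynomial ℕ)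

/-- `fstF` on codes. (Same statement as `Literature.Barriers.QuantumAdvantage.fstF_code` of
`AaronsonChenAdviceCircuitCode.lean`, outside this file's import cone; librarian: hoist into `CodeFP.lean`.)
[folklore] -/
theorem fstC : CodeFP strE strE fstF := of_fn fstF fstF_mem_FP fun _ => rfl
/-- `sndF` on codes. [folklore] -/
theorem sndC : CodeFP strE strE sndF := of_fn sndF sndF_mem_FP fun _ => rfl
/-- `boolPair` on codes. (Same statement as `SumcheckMA.strPair` of `SumcheckMAReferee.lean` and proved the
same way; not imported to keep the sumcheck development out of this cone; librarian: hoist into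
`CodeFPArith.lean`.) [folklore] -/
theorem strPairC : CodeFP (pairE strE strE) strE (fun p => boolPair p.1 p.2) := ⟨_root_.id, PolyTimeComputable.id _, fun _ => rfl⟩
/-- `0ᵏ` from `1ᵏ`. (Same statement as `MachineA.falses_code` of `Williams2014StageAFP.lean`, outside this
file's import cone; librarian: hoist into `CodeFPArith.lean`.) [folklore] -/
theorem zerosC : CodeFP unE strE (fun k => List.replicate k false) :=
  of_fn Kannan.zerosFn Kannan.zerosFn_mem_FP fun k => by rw [Kannan.zerosFn_apply, length_unE]; rfl
/-- `1ᵏ` as a string. [folklore] -/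
theorem onesC : CodeFP unE strE (fun k => List.replicate k true) := strOfUn.congr fun k => by rw [unE_eq_ones]
/-- `w ↦ 1^{c(|w|)}`. [cite: AroraBarakCC2009, §1.3] -/
theorem polyLenC : CodeFP strE unE (fun w => c.eval w.length) :=
  of_fn (Plumb.polyFn c) (Plumb.polyFn_mem_FP c) fun w => by rw [Plumb.polyFn_apply, unE_eq_ones]; rfl
/-- `(k, a, b) ↦ min (a - b) k` in unary, under a unary cap `k`. [folklore] -/
theorem minSubC : CodeFP (pairE unE (pairE natE natE)) unE (fun p => min (p.2.1 - p.2.2) p.1) :=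
  unOfNatMin.comp ((fst _ _).pair (natSub.comp (snd _ _)))

/-- `yOf` on codes. [folklore] -/
theorem yOfC : CodeFP strE strE yOf := fstC.comp fstC
/-- `advOf` on codes. [folklore] -/
theorem advOfC : CodeFP strE strE advOf := sndC.comp fstC
/-- `flagOf` on codes. [folklore] -/
theorem flagOfC : CodeFP strE bitE flagOf :=
  (CodeFP.eq (eα := strE) (fun _ _ h => h)).comp ((fstC.comp advOfC).pair (const strE [true]))
/-- `alphaOf` on codes. [folklore] -/
theorem alphaOfC : CodeFP strE natE alphaOf := strVal.comp (fstC.comp (sndC.comp advOfC))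
/-- `s2Of` on codes. [folklore] -/
theorem s2OfC : CodeFP strE natE s2Of := strVal.comp (fstC.comp (sndC.comp (sndC.comp advOfC)))
/-- `scaleOf` on codes. [folklore] -/
theorem scaleOfC : CodeFP strE natE scaleOf := strVal.comp (sndC.comp (sndC.comp (sndC.comp advOfC)))
/-- `coinsOf` on codes. [folklore] -/
theorem coinsOfC : CodeFP strE strE coinsOf := fstC.comp (sndC.comp (sndC.comp sndC))
/-- `descOf` on codes. [folklore] -/
theorem descOfC : CodeFP strE strE descOf := fstC.comp (fstC.comp (sndC.comp sndC))
/-- `capOf` on codes. [folklore] -/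
theorem capOfC : CodeFP strE unE capOf := strLength.comp coinsOfC

/-- `padY` on codes. [folklore] -/
theorem padYC : CodeFP strE strE padY :=
  strAppend.comp (yOfC.pair (zerosC.comp (minSubC.comp (capOfC.pair (scaleOfC.pair (strNatLength.comp yOfC))))))

include hg in
/-- `zA` on codes. [cite: MurrayWilliams2018, Claim 1] -/
theorem zAC : CodeFP strE strE (zA g) := (of_fn g hg fun _ => rfl : CodeFP strE strE g).comp padYC

include hg in
/-- `okA` on codes. [folklore] -/
theorem okAC : CodeFP strE bitE (okA g) := natLe.comp ((strNatLength.comp (zAC hg)).pair s2OfC)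

include hg in
/-- `qA` on codes. [folklore] -/
theorem qAC : CodeFP strE strE (qA g) :=
  strAppend.comp ((onesC.comp (minSubC.comp (capOfC.pair (s2OfC.pair (strNatLength.comp (zAC hg)))))).pair (zAC hg))

/-- `xB` on codes. [folklore] -/
theorem xBC : CodeFP strE strE xB := strDrop.comp ((const strE (1 : ℕ)).pair (stripOnesC.comp yOfC))

/-- `okB` on codes. [folklore] -/
theorem okBC : CodeFP strE bitE okB :=
  (CodeFP.not (natEq.comp ((strNatLength.comp (stripOnesC.comp yOfC)).pair (const strE (0 : ℕ))))).and
    (natLe.comp ((natAdd.comp ((strNatLength.comp xBC).pair (const strE (1 : ℕ)))).pair alphaOfC))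

/-- `qB` on codes. [folklore] -/
theorem qBC : CodeFP strE strE qB :=
  (strAppend.comp ((onesC.comp (minSubC.comp (capOfC.pair (alphaOfC.pair
    (natAdd.comp ((strNatLength.comp xBC).pair (const strE (1 : ℕ)))))))).pair
      (strAppend.comp ((const strE [false]).pair xBC)))).congr fun z => by simp [qB]

/-- `isA` on codes. [folklore] -/
theorem isAC : CodeFP strE bitE isA := natEq.comp (alphaOfC.pair s2OfC)

include hg in
/-- `okOf` on codes. [folklore] -/
theorem okOfC : CodeFP strE bitE (okOf g) := flagOfC.and (isAC.ite (okAC hg) okBC)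

include hg in
/-- `queryOf` on codes. [folklore] -/
theorem queryOfC : CodeFP strE strE (queryOf g) := isAC.ite (qAC hg) qBC

include hg in
/-- The checker's coin length `coins(|q|)`, in unary. [folklore] -/
theorem coinLenC : CodeFP strE unE (fun z => c.eval (queryOf g z).length) := by
  have hq : CodeFP strE strE (queryOf g) := queryOfC hg
  exact (polyLenC c).comp hq

include hg in
/-- Arthur's coins cut to the checker's coin length. [folklore] -/
theorem coinsCutC : CodeFP strE strE (fun z => (coinsOf z).take (c.eval (queryOf g z).length)) := by
  exact strTake.comp ((coinLenC hg c).pair coinsOfC)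

include hg in
/-- The pair `⟨q, r ↾ coins(|q|)⟩`. [folklore] -/
theorem queryCoinsC :
    CodeFP strE strE (fun z => boolPair (queryOf g z) ((coinsOf z).take (c.eval (queryOf g z).length))) := by
  exact strPairC.comp ((queryOfC hg).pair (coinsCutC hg c))

include hg in
/-- `tripleOf` on codes. [folklore] -/
theorem tripleOfC : CodeFP strE strE (tripleOf g c) := by
  exact (strPairC.comp ((queryCoinsC hg c).pair descOfC)).congr fun z => rfl

include hg in
/-- **The referee is polynomial time**: `Ref g c lang ∈ P` for `g ∈ FP` and `lang ∈ P` ("Simulating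
`M^C` can be done in time `O(s₁(n)² · s₂(n)^{d₃})`"). [cite: MurrayWilliams2018, Thm. 3.1 (MA promise and running time analysis)] -/
theorem Ref_mem_P {lang : Language Bool} (hlang : lang ∈ Classes.P) : Ref g c lang ∈ Classes.P := by
  obtain ⟨F, hF, hFs⟩ := okOfC hg
  obtain ⟨T, hT, hTs⟩ := tripleOfC hg c
  have h1 : ({z | okOf g z = true} : Language Bool) ∈ Classes.P :=
    mem_P_of_mem_FP hF _ fun z => by
      have hz : F z = [okOf g z] := hFs z
      constructor
      · intro h; rw [hz, show okOf g z = true from h]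
      · intro h; rw [hz, show okOf g z = false from Bool.eq_false_iff.2 h]
  have h2 : (T ⁻¹' lang : Language Bool) ∈ Classes.P := preimage_mem_P hlang hT
  have h3 := inter_mem_P h1 h2
  have hEq : Ref g c lang = ({z | okOf g z = true} : Language Bool) ⊓ (T ⁻¹' lang) := by
    ext z
    change okOf g z = true ∧ tripleOf g c z ∈ lang ↔ okOf g z = true ∧ T z ∈ lang
    rw [show T z = tripleOf g c z from hTs z]
  rw [hEq]
  exact h3

end PolyTime

/-! ### Values of two-move Merlin–Arthur games with a 0/1 referee -/

section Values

open AMPlayer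

variable {Rf : Language Bool} {m : ℕ} {x₀ : List Bool}

/-- **Completeness pattern**: if some move of Merlin wins against every coin string of Arthur, the
game `[merlin, arthur]` is worth `1 ≥ 2/3`. [cite: BabaiMoran1988, §2.3] -/
theorem amValue_ge_of_exists_forall
    (h : ∃ mv : List Bool, mv.length = m ∧ ∀ r : List Bool, r.length = m → boolPair x₀ (encMoves [mv, r]) ∈ Rf) :
    (2 / 3 : ℝ) ≤ amValue Rf m [merlin, arthur] x₀ := by
  obtain ⟨mv, hmv, hall⟩ := h
  let yv : List.Vector Bool m := ⟨mv, hmv⟩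
  have hval : gameValue (refereePayoff Rf x₀) m [arthur] ([] ++ [yv.toList]) = 1 := by
    rw [gameValue_arthur_of_zeroOne (fun _ => True) (fun r _ => ?_) (fun r hr => (hr trivial).elim)]
    · rw [show ({y : List Bool | True}) = Set.univ from rfl, uniformProb_univ]
    · rw [gameValue_nil]
      exact refereePayoff_of_mem (hall r.toList r.toList_length)
  have hle := le_gameValue_merlin (refereePayoff Rf x₀) m [arthur] [] yv
  rw [hval] at hle
  change (2 / 3 : ℝ) ≤ gameValue (refereePayoff Rf x₀) m [merlin, arthur] []
  linarith

/-- **Soundness pattern**: if against every move of Merlin the winning coin strings have probability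
`≤ 1/3`, the game `[merlin, arthur]` is worth `≤ 1/3`. [cite: BabaiMoran1988, §2.3] -/
theorem amValue_le_of_forall_uniformProb_le
    (h : ∀ mv : List Bool, mv.length = m → uniformProb m {r | boolPair x₀ (encMoves [mv, r]) ∈ Rf} ≤ 1 / 3) :
    amValue Rf m [merlin, arthur] x₀ ≤ 1 / 3 := by
  change gameValue (refereePayoff Rf x₀) m [merlin, arthur] [] ≤ 1 / 3
  rw [gameValue_merlin_le_iff]
  intro yv
  rw [List.nil_append, gameValue_arthur_of_zeroOne (fun r => boolPair x₀ (encMoves [yv.toList, r]) ∈ Rf)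
      (fun r hr => by rw [gameValue_nil, List.singleton_append, refereePayoff_of_mem hr])
      (fun r hr => by rw [gameValue_nil, List.singleton_append, refereePayoff_of_not_mem hr])]
  exact h yv.toList yv.toList_length

/-- **Rejection pattern**: if the referee accepts no game string, the game is worth `0 ≤ 1/3`. [cite: BabaiMoran1988, §2.3] -/
theorem amValue_le_of_forall_not_mem
    (h : ∀ mv r : List Bool, r.length = m → boolPair x₀ (encMoves [mv, r]) ∉ Rf) :
    amValue Rf m [merlin, arthur] x₀ ≤ 1 / 3 := by
  refine amValue_le_of_forall_uniformProb_le fun mv _ => ?_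
  have hc := uniformProb_congr (m := m) (E := {r | boolPair x₀ (encMoves [mv, r]) ∈ Rf}) (E' := ∅)
    fun r hr => ⟨fun hm => (h mv r hr hm).elim, fun hm => hm.elim⟩
  rw [hc, uniformProb_empty]
  norm_num

/-- Monotonicity of the counting probability (local copy; see `uniformProb_mono` of
`PromiseCookMachine.lean`, not importable here). [folklore] -/
theorem uniformProb_mono_set {E E' : Set (List Bool)} (h : E ⊆ E') : uniformProb m E ≤ uniformProb m E' := by
  classical
  unfold uniformProb
  refine div_le_div_of_nonneg_right ?_ (by positivity)
  exact_mod_cast Finset.card_le_card fun r hr => by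
    simp only [Finset.mem_filter, Finset.mem_univ, true_and] at hr ⊢
    exact h hr

end Values

/-! ### Playing the checker against Merlin's circuit: the two halves of the MA promise -/

section Play

variable {Lstar : Language Bool} (chk : AlmostAE.SameLengthChecker Lstar)
variable {Rf : Language Bool} {x₀ q : List Bool} {m S₁ : ℕ}

/-- Iterated paddability: `1ᵏ z ∈ Lstar ⟺ z ∈ Lstar`. [cite: MurrayWilliams2018, Thm. 2.2 (paddability)] -/
theorem replicate_append_mem_iff (hpad : ∀ z : List Bool, true :: z ∈ Lstar ↔ z ∈ Lstar) (k : ℕ)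
    (z : List Bool) : List.replicate k true ++ z ∈ Lstar ↔ z ∈ Lstar := by
  induction k with
  | zero => rfl
  | succ k ih => rw [List.replicate_succ, List.cons_append, hpad, ih]

/-- **Completeness of one play** ("there is a (Merlin) circuit `C` of size `s₁(n)` such that
`M^C(q)` (Arthur) accepts with probability `1`"): if on game strings the referee accepts exactly when
the checker accepts `⟨⟨q, r ↾ coins(|q|)⟩, d⟩` (`d` the first component of Merlin's move), the coins
and a description of an `S₁`-size circuit for the slice at `|q|` fit into the move length `m`, the
slice has such a circuit, and `q ∈ Lstar`, then Merlin wins with probability `1 ≥ 2/3`: he plays a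
correct description, padded. [cite: MurrayWilliams2018, Thm. 3.1 (MA promise and running time analysis)] -/
theorem amValue_ge_of_mem
    (href : ∀ mv r : List Bool, r.length = m →
      (boolPair x₀ (encMoves [mv, r]) ∈ Rf ↔
        boolPair (boolPair q (r.take (chk.coins.eval q.length))) (fstF mv) ∈ chk.lang))
    (hcoins : chk.coins.eval q.length ≤ m)
    (hdesc : 2 * ((S₁ + 1) * (8 * (q.length + S₁) + 10)) + 2 ≤ m)
    (hsize : Lstar.circuitSize q.length ≤ S₁) (hq : q ∈ Lstar) :
    (2 / 3 : ℝ) ≤ amValue Rf m [AMPlayer.merlin, AMPlayer.arthur] x₀ := by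
  obtain ⟨d, hd, hdlen⟩ := AlmostAE.exists_describesSlice Lstar q.length
  have hdB : d.length ≤ (S₁ + 1) * (8 * (q.length + S₁) + 10) :=
    hdlen.trans (Nat.mul_le_mul (by omega) (by omega))
  refine amValue_ge_of_exists_forall ⟨boolPair d (List.replicate (m - (2 * d.length + 2)) false), ?_, ?_⟩
  · rw [length_boolPair, List.length_replicate]; omega
  · intro r hr
    rw [href _ r hr, fstF_boolPair]
    refine chk.complete q.length d hd q hq rfl _ ?_
    rw [List.length_take, hr, min_eq_left hcoins]

/-- **Soundness of one play** ("for every possible (Merlin) circuit `C`, `M^C(q)` (Arthur) will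
reject with probability at least `2/3`"): with the referee as above and `q ∉ Lstar`, every move of
Merlin wins with probability `≤ 1/3` — the winning coin strings form the cylinder over the checker's
bad coin set. [cite: MurrayWilliams2018, Thm. 3.1 (MA promise and running time analysis)] -/
theorem amValue_le_of_not_mem
    (href : ∀ mv r : List Bool, r.length = m →
      (boolPair x₀ (encMoves [mv, r]) ∈ Rf ↔
        boolPair (boolPair q (r.take (chk.coins.eval q.length))) (fstF mv) ∈ chk.lang))
    (hcoins : chk.coins.eval q.length ≤ m) (hq : q ∉ Lstar) :
    amValue Rf m [AMPlayer.merlin, AMPlayer.arthur] x₀ ≤ 1 / 3 := by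
  refine amValue_le_of_forall_uniformProb_le fun mv _ => ?_
  have hc := uniformProb_congr (m := m) (E := {r | boolPair x₀ (encMoves [mv, r]) ∈ Rf})
    (E' := {r | r.take (chk.coins.eval q.length) ∈ {r' | boolPair (boolPair q r') (fstF mv) ∈ chk.lang}})
    fun r hr => href mv r hr
  rw [hc, uniformProb_take_of_le hcoins]
  exact chk.sound q hq (fstF mv)

end Play

/-! ### The referee on game strings with the two advice regimes -/

section GameStrings

variable (g : List Bool → List Bool) (c : Polynomial ℕ) (lang : Language Bool)

/-- On a bad length (flag `0`) the referee rejects. [folklore] -/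
theorem not_mem_Ref_bad (y mv r : List Bool) :
    boolPair (boolPair y (advCode false 0 0 0)) (encMoves [mv, r]) ∉ Ref g c lang := by
  rw [encMoves_two, mem_Ref_iff, okOf, flagOf_game]
  simp

variable {g c lang}

/-- **Branch `αₙ = s₂(n)` on game strings**: the referee accepts iff the checker accepts
`⟨⟨1^{S-|z|} z, r ↾ coins(S)⟩, d⟩`, `z = g (pad N y)` (given the paddings fit the budget `|r|` and
`|z| ≤ S`). [cite: MurrayWilliams2018, Thm. 3.1 (the protocol M₁, first branch)] -/
theorem mem_Ref_game_A {y mv r : List Bool} {α S N : ℕ} (hα : α = S) (hN : N - y.length ≤ r.length)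
    (hS : S ≤ r.length) (hz : (g (y ++ List.replicate (N - y.length) false)).length ≤ S) :
    boolPair (boolPair y (advCode true α S N)) (encMoves [mv, r]) ∈ Ref g c lang ↔
      boolPair (boolPair
        (List.replicate (S - (g (y ++ List.replicate (N - y.length) false)).length) true ++
          g (y ++ List.replicate (N - y.length) false))
        (r.take (c.eval S))) (fstF mv) ∈ lang := by
  subst hα
  rw [encMoves_two, mem_Ref_iff]
  have hpad : padY (boolPair (boolPair y (advCode true α α N))
      (boolPair [true, true] (boolPair mv (boolPair r [])))) = y ++ List.replicate (N - y.length) false := by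
    simp [padY, capOf, min_eq_left hN]
  have hq : queryOf g (boolPair (boolPair y (advCode true α α N))
      (boolPair [true, true] (boolPair mv (boolPair r [])))) =
      List.replicate (α - (g (y ++ List.replicate (N - y.length) false)).length) true ++
        g (y ++ List.replicate (N - y.length) false) := by
    simp [queryOf, isA, qA, zA, hpad, capOf, min_eq_left ((Nat.sub_le _ _).trans hS)]
  have hlen : (List.replicate (α - (g (y ++ List.replicate (N - y.length) false)).length) true ++
      g (y ++ List.replicate (N - y.length) false)).length = α := by
    rw [List.length_append, List.length_replicate]; omega
  simp [okOf, isA, okA, zA, hpad, hz, tripleOf, hq, hlen]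

/-- **Branch `αₙ < s₂(n)` on game strings, playable case**: for `y = 1ᵃ 0 x` with `|x| + 1 ≤ α` the
referee accepts iff the checker accepts `⟨⟨1^{α-|x|-1} 0 x, r ↾ coins(α)⟩, d⟩`.
[cite: MurrayWilliams2018, Thm. 3.1 (the protocol M₁, second branch)] -/
theorem mem_Ref_game_B {x mv r : List Bool} {a α S N : ℕ} (hα : α ≠ S) (hαr : α ≤ r.length)
    (hx : x.length + 1 ≤ α) :
    boolPair (boolPair (List.replicate a true ++ false :: x) (advCode true α S N)) (encMoves [mv, r]) ∈ Ref g c lang ↔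
      boolPair (boolPair (List.replicate (α - (x.length + 1)) true ++ false :: x) (r.take (c.eval α))) (fstF mv) ∈
        lang := by
  rw [encMoves_two, mem_Ref_iff]
  have hq : queryOf g (boolPair (boolPair (List.replicate a true ++ false :: x) (advCode true α S N))
      (boolPair [true, true] (boolPair mv (boolPair r [])))) =
      List.replicate (α - (x.length + 1)) true ++ false :: x := by
    simp [queryOf, isA, hα, qB, xB, capOf, min_eq_left ((Nat.sub_le _ _).trans hαr)]
  have hlen : (List.replicate (α - (x.length + 1)) true ++ false :: x).length = α := by
    rw [List.length_append, List.length_replicate, List.length_cons]; omega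
  simp [okOf, isA, hα, okB, xB, hx, tripleOf, hq, hlen]

/-- Branch `αₙ < s₂(n)`, all-ones input: rejected. [cite: MurrayWilliams2018, Thm. 3.1 (the protocol M₁)] -/
theorem not_mem_Ref_game_B_ones {mv r : List Bool} {n α S N : ℕ} (hα : α ≠ S) :
    boolPair (boolPair (List.replicate n true) (advCode true α S N)) (encMoves [mv, r]) ∉ Ref g c lang := by
  rw [encMoves_two, mem_Ref_iff]
  simp [okOf, isA, hα, okB]

/-- Branch `αₙ < s₂(n)`, payload too long (`|x| + 1 > αₙ`): rejected.
[cite: MurrayWilliams2018, Thm. 3.1 ("If |x| + 1 > αₙ then reject")] -/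
theorem not_mem_Ref_game_B_long {x mv r : List Bool} {a α S N : ℕ} (hα : α ≠ S) (hx : α < x.length + 1) :
    boolPair (boolPair (List.replicate a true ++ false :: x) (advCode true α S N)) (encMoves [mv, r]) ∉
      Ref g c lang := by
  rw [encMoves_two, mem_Ref_iff]
  simp [okOf, isA, hα, okB, xB]
  omega

end GameStrings

/-! ### Good lengths, the advice and the language `L₁` -/

section Good

open Filter KannanScaled

variable {Lstar : Language Bool}

/-- **A good length**: the pointwise inequalities under which the protocol can be played at length
`n` with move length `(s₁ n · s₂ n)^D`, coin polynomial `c`, and a reduction `g` of output length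
`≤ cg · |w|^dg + cg` — all consequences, for large `n`, of the constraints (i)–(iii) of Thm. 3.1
(`eventually_goodLen`). [cite: MurrayWilliams2018, Thm. 3.1 (constraints (i)–(iii))] -/
structure GoodLen (c : Polynomial ℕ) (dg cg : ℕ) (s s₁ s₂ : ℕ → ℕ) (D n : ℕ) : Prop where
  /-- the scale of the diagonal language fits: `N(n) ≤ s₂(n)` -/
  scale_le : scale s n ≤ s₂ n
  /-- the reduced query fits: `|R(y)| ≤ s₂(n)` ("by constraint (i)") -/
  red_le : cg * scale s n ^ dg + cg ≤ s₂ n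
  /-- Merlin's circuits exist: `1 ≤ s₁(n)` -/
  one_le : 1 ≤ s₁ n
  /-- Arthur's coins fit into his move -/
  coins_le : c.eval (s₂ n) ≤ (s₁ n * s₂ n) ^ D
  /-- a description of an `s₁(n)`-size circuit on `≤ s₂(n)` inputs fits into Merlin's move -/
  desc_le : 2 * ((s₁ n + 1) * (8 * (s₂ n + s₁ n) + 10)) + 2 ≤ (s₁ n * s₂ n) ^ D
  /-- the unary paddings fit -/
  s₂_le : s₂ n ≤ (s₁ n * s₂ n) ^ D

variable (Lstar) (c : Polynomial ℕ) (dg cg : ℕ) (s s₁ s₂ : ℕ → ℕ) (D : ℕ)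

open Classical in
/-- **The advice**: on a good length `⟨1, αₙ, s₂(n), N(n)⟩`, on a bad one `⟨0, 0, 0, 0⟩`.
[cite: MurrayWilliams2018, Thm. 3.1 (display (2))] -/
def goodAdv (n : ℕ) : List Bool :=
  if GoodLen c dg cg s s₁ s₂ D n then advCode true (AlmostAE.advice Lstar s₁ s₂ n) (s₂ n) (scale s n)
  else advCode false 0 0 0

/-- **The language `L₁` decided by the protocol**: Murray–Williams' `hardLang` (what `M₁` decides
under its promise) on the good lengths, empty on the finitely many bad ones — a finite modification,
immaterial for the eventual hardness. [cite: MurrayWilliams2018, Thm. 3.1 (the language L₁)] -/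
def goodLang : Language Bool :=
  {y | GoodLen c dg cg s s₁ s₂ D y.length ∧ y ∈ AlmostAE.hardLang Lstar (diag (scale s)) s₁ s₂}

variable {Lstar c dg cg s s₁ s₂ D}

/-- The advice on a good length. [folklore] -/
theorem goodAdv_of_good {n : ℕ} (h : GoodLen c dg cg s s₁ s₂ D n) :
    goodAdv Lstar c dg cg s s₁ s₂ D n = advCode true (AlmostAE.advice Lstar s₁ s₂ n) (s₂ n) (scale s n) := by
  simp [goodAdv, h]

/-- The advice on a bad length. [folklore] -/
theorem goodAdv_of_bad {n : ℕ} (h : ¬ GoodLen c dg cg s s₁ s₂ D n) :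
    goodAdv Lstar c dg cg s s₁ s₂ D n = advCode false 0 0 0 := by
  simp [goodAdv, h]

/-- **The advice is short**: `≤ 13 (log₂ s₂(n) + 1)` bits. [cite: MurrayWilliams2018, Thm. 3.1 ("2 log s₂(n) advice")] -/
theorem length_goodAdv_le (n : ℕ) : (goodAdv Lstar c dg cg s s₁ s₂ D n).length ≤ 13 * (Nat.log 2 (s₂ n) + 1) := by
  by_cases h : GoodLen c dg cg s s₁ s₂ D n
  · rw [goodAdv_of_good h]
    exact length_advCode_le (AlmostAE.advice_le n) h.scale_le
  · rw [goodAdv_of_bad h, length_advCode_false]; omega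

/-- `L₁` agrees with `hardLang` on good lengths. [folklore] -/
theorem mem_goodLang_iff_of_good {y : List Bool} (h : GoodLen c dg cg s s₁ s₂ D y.length) :
    y ∈ goodLang Lstar c dg cg s s₁ s₂ D ↔ y ∈ AlmostAE.hardLang Lstar (diag (scale s)) s₁ s₂ :=
  ⟨fun hy => hy.2, fun hy => ⟨h, hy⟩⟩

end Good

/-! ### The MA promise of the protocol on all inputs -/

section Promise

open Filter KannanScaled AlmostAE

variable {Lstar : Language Bool} (chk : SameLengthChecker Lstar)
variable {g : List Bool → List Bool} {dg cg : ℕ} {s s₁ s₂ : ℕ → ℕ} {D : ℕ}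

/-- **The protocol `M₁` with its advice satisfies the MA promise on all inputs and decides `L₁`**
(Murray–Williams 2018, Thm. 3.1, "MA Promise and Running Time Analysis": "If `αₙ = s₂(n)` … If
`y ∈ L_diag`, then `1^{s₂(n)-|z|} z ∈ L_PSPACE`, which means there is a (Merlin) circuit `C` of size
`s₁(n)` such that `M^C(z)` (Arthur) accepts with probability `1` … If `y ∉ L_diag`, then for every
possible (Merlin) circuit `C`, … `M^C` (Arthur) will reject with probability at least `2/3`. … If
`αₙ < s₂(n)` … by the paddability of `L_PSPACE` … for every possible circuit `C`, `M^C(1^{αₙ-|x|-1}0x)`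
rejects with probability at least `2/3`"), for the referee `Ref g coins lang`, move length
`(s₁ n · s₂ n)^D`, the advice `goodAdv` and the language `goodLang` (= `hardLang` on good lengths,
empty on bad ones, where the referee rejects). Hypotheses: paddability and no all-ones word of
`Lstar`, the reduction `g` of the diagonal language (Claim 1) with its output-length bound, `n ≤ s n`.
[cite: MurrayWilliams2018, Thm. 3.1 (MA promise and running time analysis)] -/
theorem advisedMAGame_goodLang
    (hpad : ∀ z : List Bool, true :: z ∈ Lstar ↔ z ∈ Lstar)
    (hones : ∀ b : ℕ, List.replicate b true ∉ Lstar)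
    (hred : ∀ y : List Bool, y ∈ diag (scale s) ↔ g (Kannan.pad (scale s y.length) y) ∈ Lstar)
    (hg : ∀ w : List Bool, (g w).length ≤ cg * w.length ^ dg + cg)
    (hs : ∀ n, n ≤ s n) :
    AdvisedMAGame (Ref g chk.coins chk.lang) (fun n => (s₁ n * s₂ n) ^ D)
      (goodAdv Lstar chk.coins dg cg s s₁ s₂ D) (goodLang Lstar chk.coins dg cg s s₁ s₂ D) := by
  intro y
  change (y ∈ goodLang Lstar chk.coins dg cg s s₁ s₂ D →
      (2 / 3 : ℝ) ≤ amValue (Ref g chk.coins chk.lang) ((s₁ y.length * s₂ y.length) ^ D)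
        [AMPlayer.merlin, AMPlayer.arthur] (boolPair y (goodAdv Lstar chk.coins dg cg s s₁ s₂ D y.length))) ∧
    (y ∉ goodLang Lstar chk.coins dg cg s s₁ s₂ D →
      amValue (Ref g chk.coins chk.lang) ((s₁ y.length * s₂ y.length) ^ D)
        [AMPlayer.merlin, AMPlayer.arthur] (boolPair y (goodAdv Lstar chk.coins dg cg s s₁ s₂ D y.length)) ≤ 1 / 3)
  set n := y.length with hn
  by_cases hgood : GoodLen chk.coins dg cg s s₁ s₂ D n
  · rw [goodAdv_of_good hgood]
    have hnN : n ≤ scale s n := by rw [scale_apply]; have := hs n; omega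
    set α := AlmostAE.advice Lstar s₁ s₂ n with hαdef
    have hαle : α ≤ s₂ n := AlmostAE.advice_le n
    have hsz : Lstar.circuitSize α ≤ s₁ n := AlmostAE.circuitSize_advice_le hgood.one_le
    set m := (s₁ n * s₂ n) ^ D with hm
    by_cases hαS : α = s₂ n
    · -- first branch: simulate `L_diag` on `y`
      set w := g (y ++ List.replicate (scale s n - n) false) with hw
      have hpadEq : Kannan.pad (scale s n) y = y ++ List.replicate (scale s n - n) false := rfl
      have hwlen : w.length ≤ s₂ n := by
        have h1 : (y ++ List.replicate (scale s n - n) false).length = scale s n := by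
          rw [List.length_append, List.length_replicate]; omega
        have h2 := hg (y ++ List.replicate (scale s n - n) false)
        rw [h1] at h2
        exact h2.trans hgood.red_le
      set q := List.replicate (s₂ n - w.length) true ++ w with hq
      have hqlen : q.length = s₂ n := by rw [hq, List.length_append, List.length_replicate]; omega
      have hiff : y ∈ goodLang Lstar chk.coins dg cg s s₁ s₂ D ↔ q ∈ Lstar := by
        rw [mem_goodLang_iff_of_good hgood, mem_hardLang_iff_of_eq hαS y rfl, hred y, hpadEq, ← hw, hq,
          replicate_append_mem_iff hpad]
      have href : ∀ mv r : List Bool, r.length = m →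
          (boolPair (boolPair y (advCode true α (s₂ n) (scale s n))) (encMoves [mv, r]) ∈ Ref g chk.coins chk.lang ↔
            boolPair (boolPair q (r.take (chk.coins.eval q.length))) (fstF mv) ∈ chk.lang) := by
        intro mv r hr
        rw [hqlen]
        refine mem_Ref_game_A hαS ?_ ?_ hwlen
        · rw [hr]; exact le_trans (Nat.sub_le _ _) (hgood.scale_le.trans hgood.s₂_le)
        · rw [hr]; exact hgood.s₂_le
      refine ⟨fun hy => ?_, fun hy => ?_⟩
      · refine amValue_ge_of_mem chk (S₁ := s₁ n) href ?_ ?_ ?_ (hiff.1 hy)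
        · rw [hqlen]; exact hgood.coins_le
        · rw [hqlen]; exact hgood.desc_le
        · rw [hqlen, ← hαS]; exact hsz
      · refine amValue_le_of_not_mem chk href ?_ fun h => hy (hiff.2 h)
        rw [hqlen]; exact hgood.coins_le
    · -- second branch: simulate `L_PSPACE` on a padded input
      have hαlt : α < s₂ n := lt_of_le_of_ne hαle hαS
      rcases eq_replicate_or_exists y with ⟨hy1, -⟩ | ⟨a, x, hyx, hsx⟩
      · -- `y = 1ⁿ`: not of the form `1ᵃ0x`, rejected
        have hnot : y ∉ goodLang Lstar chk.coins dg cg s s₁ s₂ D := by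
          rw [mem_goodLang_iff_of_good hgood, mem_hardLang_iff_of_lt hαlt y rfl]
          rintro ⟨a, x, hax, -, -⟩
          have hf : false ∈ y := by rw [hax]; simp
          rw [hy1] at hf
          simp at hf
        refine ⟨fun hy => (hnot hy).elim, fun _ => ?_⟩
        rw [hy1]
        exact amValue_le_of_forall_not_mem fun mv r _ => not_mem_Ref_game_B_ones hαS
      · by_cases hx : x.length + 1 ≤ α
        · set q := List.replicate (α - (x.length + 1)) true ++ false :: x with hq
          have hqlen : q.length = α := by
            rw [hq, List.length_append, List.length_replicate, List.length_cons]; omega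
          have han : a + (false :: x).length = n := by
            rw [hn, hyx, List.length_append, List.length_replicate]
          have hiff : y ∈ goodLang Lstar chk.coins dg cg s s₁ s₂ D ↔ q ∈ Lstar := by
            rw [mem_goodLang_iff_of_good hgood, hyx, replicate_append_mem_hardLang_iff hpad hones hαlt a (false :: x)
              han (by simpa using hx), hq, replicate_append_mem_iff hpad]
          have href : ∀ mv r : List Bool, r.length = m →
              (boolPair (boolPair y (advCode true α (s₂ n) (scale s n))) (encMoves [mv, r]) ∈ Ref g chk.coins chk.lang ↔
                boolPair (boolPair q (r.take (chk.coins.eval q.length))) (fstF mv) ∈ chk.lang) := by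
            intro mv r hr
            rw [hqlen, hyx]
            refine mem_Ref_game_B hαS ?_ hx
            rw [hr]; exact hαle.trans hgood.s₂_le
          refine ⟨fun hy => ?_, fun hy => ?_⟩
          · refine amValue_ge_of_mem chk (S₁ := s₁ n) href ?_ ?_ ?_ (hiff.1 hy)
            · rw [hqlen]; exact (natPoly_eval_mono _ hαle).trans hgood.coins_le
            · rw [hqlen]
              refine le_trans ?_ hgood.desc_le
              have : 8 * (α + s₁ n) + 10 ≤ 8 * (s₂ n + s₁ n) + 10 := by omega
              exact Nat.add_le_add_right (Nat.mul_le_mul_left _ (Nat.mul_le_mul_left _ this)) _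
            · rw [hqlen]; exact hsz
          · refine amValue_le_of_not_mem chk href ?_ fun h => hy (hiff.2 h)
            rw [hqlen]; exact (natPoly_eval_mono _ hαle).trans hgood.coins_le
        · -- payload too long: rejected, and not in `L₁`
          rw [not_le] at hx
          have hnot : y ∉ goodLang Lstar chk.coins dg cg s s₁ s₂ D := by
            rw [mem_goodLang_iff_of_good hgood, mem_hardLang_iff_of_lt hαlt y rfl]
            rintro ⟨a', x', hax, hx', -⟩
            have h1 : stripOnes y = false :: x' := by rw [hax, stripOnes_replicate_append]
            rw [hsx] at h1
            have h2 : x = x' := (List.cons.inj h1).2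
            rw [h2] at hx
            exact absurd hx' (not_le.2 hx)
          refine ⟨fun hy => (hnot hy).elim, fun _ => ?_⟩
          rw [hyx]
          exact amValue_le_of_forall_not_mem fun mv r _ => not_mem_Ref_game_B_long hαS hx
  · -- a bad length: the referee rejects, and `L₁` is empty there
    rw [goodAdv_of_bad hgood]
    exact ⟨fun hy => (hgood hy.1).elim, fun _ =>
      amValue_le_of_forall_not_mem fun mv r _ => not_mem_Ref_bad g chk.coins chk.lang y mv r⟩

/-! ### The constraints of Theorem 3.1 make all large lengths good -/

/-- A polynomial bound in the shape `C · n^d + C`. [folklore] -/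
theorem eval_le_mul_pow_add (p : Polynomial ℕ) (n : ℕ) : p.eval n ≤ p.eval 1 * n ^ p.natDegree + p.eval 1 := by
  rcases Nat.eq_zero_or_pos n with rfl | hn
  · exact (natPoly_eval_mono p (Nat.zero_le 1)).trans (Nat.le_add_left _ _)
  · exact (natPoly_eval_le_eval_one_mul_pow p hn).trans (Nat.le_add_right _ _)

/-- The description-length numerics: `2(u+1)(8(v+u)+10) + 2 ≤ (uv)³` for `u, v ≥ 11`. [folklore] -/
theorem desc_numerics {u v : ℕ} (hu : 11 ≤ u) (hv : 11 ≤ v) :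
    2 * ((u + 1) * (8 * (v + u) + 10)) + 2 ≤ (u * v) ^ 3 := by
  have huv : 121 ≤ u * v := by nlinarith
  have h1 : 16 * (u * v) ≤ (u * v) * (u * v) := Nat.mul_le_mul_right _ (by omega)
  have h2a : 4 * u ≤ u * v := by nlinarith
  have h2 : 16 * (u * u) ≤ (u * v) * (u * v) :=
    calc 16 * (u * u) = (4 * u) * (4 * u) := by ring
      _ ≤ (u * v) * (u * v) := Nat.mul_le_mul h2a h2a
  have h3 : 74 * (u * v) ≤ (u * v) * (u * v) := Nat.mul_le_mul_right _ (by omega)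
  have h4 : 36 * u + 16 * v + 22 ≤ 74 * (u * v) := by nlinarith
  have h5 : 3 * ((u * v) * (u * v)) ≤ (u * v) ^ 3 :=
    calc 3 * ((u * v) * (u * v)) ≤ (u * v) * ((u * v) * (u * v)) := Nat.mul_le_mul_right _ (by omega)
      _ = (u * v) ^ 3 := by ring
  have hL : 2 * ((u + 1) * (8 * (v + u) + 10)) + 2 = 16 * (u * v) + 16 * (u * u) + (36 * u + 16 * v + 22) := by
    ring
  rw [hL]
  calc 16 * (u * v) + 16 * (u * u) + (36 * u + 16 * v + 22)
      ≤ (u * v) * (u * v) + (u * v) * (u * v) + 74 * (u * v) := Nat.add_le_add (Nat.add_le_add h1 h2) h4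
    _ ≤ (u * v) * (u * v) + (u * v) * (u * v) + (u * v) * (u * v) := Nat.add_le_add_left h3 _
    _ = 3 * ((u * v) * (u * v)) := by ring
    _ ≤ (u * v) ^ 3 := h5

/-- **All large lengths are good** under the constraints (i) `(n + s n + 2)^D ≤ s₂ n` and
(iii) `(n + s n + 2)^D ≤ s₁ n` of Theorem 3.1 (universal-referee form), once `D` dominates the
exponents of the reduction and of the coin polynomial and `D ≥ 13`.
[cite: MurrayWilliams2018, Thm. 3.1 (constraints (i)–(iii)) and Lemma 4.1 (proof: "Let us check that these functions satisfy all the constraints of Theorem 3.1")] -/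
theorem eventually_goodLen {c : Polynomial ℕ} {dc cc : ℕ} (hc : ∀ x, c.eval x ≤ cc * x ^ dc + cc)
    (hs : StrictMono s) (hdg : dg + 1 ≤ D) (hdc : dc + 1 ≤ D) (h3 : 3 ≤ D)
    (hs₁ : ∀ n, n ≤ s₁ n) (hs₂ : ∀ n, n ≤ s₂ n)
    (hi : ∀ᶠ n in atTop, (n + s n + 2) ^ D ≤ s₂ n) (hiii : ∀ᶠ n in atTop, (n + s n + 2) ^ D ≤ s₁ n) :
    ∀ᶠ n in atTop, GoodLen c dg cg s s₁ s₂ D n := by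
  have hsn : ∀ n, n ≤ s n := fun n => hs.id_le n
  filter_upwards [hi, hiii, eventually_ge_atTop (cg * 10 ^ dg + cg + 2 * cc + 11)] with n hn₂ hn₁ hn
  set t := n + s n + 2 with ht
  have ht12 : 12 ≤ t := by omega
  have htn : n ≤ t := by omega
  have hpowD : ∀ k, k ≤ D → t ^ k ≤ t ^ D := fun k hk => Nat.pow_le_pow_right (by omega) hk
  have h11s₂ : 11 ≤ s₂ n := le_trans (by omega) (hs₂ n)
  have h11s₁ : 11 ≤ s₁ n := le_trans (by omega) (hs₁ n)
  have hD1 : 1 ≤ D := by omega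
  refine ⟨?_, ?_, ?_, ?_, ?_, ?_⟩
  · -- `N(n) = 10(s n + 2) ≤ t² ≤ t^D ≤ s₂ n`
    rw [scale_apply]
    have h1 : 10 * (s n + 2) ≤ t ^ 2 := by nlinarith
    exact h1.trans ((hpowD 2 (by omega)).trans hn₂)
  · -- `cg N(n)^dg + cg ≤ (cg 10^dg + cg) t^dg ≤ t^(dg+1) ≤ s₂ n`
    rw [scale_apply]
    have h10 : 10 * (s n + 2) ≤ 10 * t := by omega
    have htpos : 1 ≤ t ^ dg := Nat.one_le_pow _ _ (by omega)
    calc cg * (10 * (s n + 2)) ^ dg + cg ≤ cg * (10 * t) ^ dg + cg :=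
          Nat.add_le_add_right (Nat.mul_le_mul_left _ (Nat.pow_le_pow_left h10 _)) _
      _ = cg * 10 ^ dg * t ^ dg + cg := by rw [Nat.mul_pow, Nat.mul_assoc]
      _ ≤ cg * 10 ^ dg * t ^ dg + cg * t ^ dg := Nat.add_le_add_left (Nat.le_mul_of_pos_right _ htpos) _
      _ = (cg * 10 ^ dg + cg) * t ^ dg := by ring
      _ ≤ t * t ^ dg := Nat.mul_le_mul_right _ (by omega)
      _ = t ^ (dg + 1) := by ring
      _ ≤ t ^ D := hpowD _ hdg
      _ ≤ s₂ n := hn₂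
  · exact le_trans (Nat.one_le_pow _ _ (by omega)) hn₁
  · -- `c(s₂ n) ≤ 2 cc x^dc ≤ x^(dc+1) ≤ x^D ≤ (s₁ n x)^D`
    have hx : 2 * cc + 11 ≤ s₂ n := le_trans (by omega) (hs₂ n)
    have hxpos : 1 ≤ s₂ n ^ dc := Nat.one_le_pow _ _ (by omega)
    calc c.eval (s₂ n) ≤ cc * s₂ n ^ dc + cc := hc _
      _ ≤ cc * s₂ n ^ dc + cc * s₂ n ^ dc := Nat.add_le_add_left (Nat.le_mul_of_pos_right _ hxpos) _
      _ = (2 * cc) * s₂ n ^ dc := by ring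
      _ ≤ s₂ n * s₂ n ^ dc := Nat.mul_le_mul_right _ (by omega)
      _ = s₂ n ^ (dc + 1) := by ring
      _ ≤ s₂ n ^ D := Nat.pow_le_pow_right (by omega) hdc
      _ ≤ (s₁ n * s₂ n) ^ D := Nat.pow_le_pow_left (Nat.le_mul_of_pos_left _ (by omega)) _
  · exact (desc_numerics h11s₁ h11s₂).trans (Nat.pow_le_pow_right (Nat.mul_pos (by omega) (by omega)) h3)
  · calc s₂ n ≤ s₁ n * s₂ n := Nat.le_mul_of_pos_left _ (by omega)
      _ ≤ (s₁ n * s₂ n) ^ D := Nat.le_self_pow (by omega) _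

/-! ### Theorem 3.1 in universal-referee form from a same-length checkable `Lstar` -/

/-- **Murray–Williams 2018, Theorem 3.1 (universal-referee form) for every `PSPACE`-hard, paddable,
downward self-reducible, same-length checkable `Lstar` without all-ones words** — i.e. from the
language of Thm. 2.2 (Santhanam 2007 / Trevisan–Vadhan), given here as hypotheses. ONE referee
`Ref ∈ P` (the protocol `M₁` over the reduction of Claim 1 and the checker) and ONE exponent `D`
serve all `s, s₁, s₂` under the constraints (i)–(iii) (eventual, generous form of
`MurrayWilliams2018EasyWitnessAssembly.lean`): the advice has `≤ D (log₂ s₂(n) + 1)` bits, the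
advised game satisfies the MA promise everywhere and decides `L₁` (`goodLang`:
`AlmostAE.hardLang Lstar (KannanScaled.diag (scale s)) s₁ s₂` off finitely many lengths), and
`L₁` is hard at `n` or at `s₂ n` for all large `n` (the proved hardness half,
`AlmostAE.eventually_lt_circuitSize_hardLang_or`, with Thm. 2.3 supplied by
`KannanScaled.eventually_lt_circuitSize_diag`). This is the hypothesis `h31` of
`MurrayWilliams2018_lemma_4_1_ae_of_thm_3_1_universal_of_simulation` /
`…_of_umansGenerator` and of `MurrayWilliams2018_NQP_not_subset_ACC0_of_thm_3_1_universal_of_qsimulation`.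
[cite: MurrayWilliams2018, Thm. 3.1] -/
theorem h31_of_sameLengthChecker (Lstar : Language Bool) (hhard : IsHard PSPACE Lstar)
    (hpad : ∀ z : List Bool, true :: z ∈ Lstar ↔ z ∈ Lstar)
    (hones : ∀ b : ℕ, List.replicate b true ∉ Lstar) (R : DSR Lstar) (chk : SameLengthChecker Lstar) :
    ∃ Ref : Language Bool, Ref ∈ Classes.P ∧ ∃ D : ℕ, 1 ≤ D ∧
      ∀ (s s₁ s₂ : ℕ → ℕ), StrictMono s → IsTimeConstructible s →
        (∀ᶠ n in atTop, n * s n ^ 2 < 2 ^ n) →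
        IsTimeConstructible s₁ → IsTimeConstructible s₂ →
        (∀ᶠ n in atTop, (n + s n + 2) ^ D ≤ s₂ n) → (∀ᶠ n in atTop, s (s₂ n) ^ D ≤ s₁ n) →
        (∀ᶠ n in atTop, (n + s n + 2) ^ D ≤ s₁ n) →
        ∃ (adv : ℕ → List Bool) (L₁ : Language Bool),
          (∀ n, (adv n).length ≤ D * (Nat.log 2 (s₂ n) + 1)) ∧
          AdvisedMAGame Ref (fun n => (s₁ n * s₂ n) ^ D) adv L₁ ∧
          ∀ᶠ n in atTop, s n < L₁.circuitSize n ∨ s (s₂ n) < L₁.circuitSize (s₂ n) := by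
  obtain ⟨g, hgFP, ⟨pg, hpg⟩, hred⟩ := exists_reduction_of_isHard hhard
  obtain ⟨q, hq⟩ := R.exists_circuitSize_succ_le
  obtain ⟨A, hA⟩ := MWSimN.exists_exp_dominating q
  have hg' : ∀ w : List Bool, (g w).length ≤ pg.eval 1 * w.length ^ pg.natDegree + pg.eval 1 :=
    fun w => (hpg w).trans (eval_le_mul_pow_add pg _)
  have hc' : ∀ x, chk.coins.eval x ≤ chk.coins.eval 1 * x ^ chk.coins.natDegree + chk.coins.eval 1 :=
    fun x => eval_le_mul_pow_add _ _
  refine ⟨Ref g chk.coins chk.lang, Ref_mem_P hgFP chk.coins chk.mem_P,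
    pg.natDegree + chk.coins.natDegree + A + 16, by omega, fun s s₁ s₂ hs hsc hsmall h₁ h₂ hi hii hiii => ?_⟩
  set D := pg.natDegree + chk.coins.natDegree + A + 16 with hD
  refine ⟨goodAdv Lstar chk.coins pg.natDegree (pg.eval 1) s s₁ s₂ D,
    goodLang Lstar chk.coins pg.natDegree (pg.eval 1) s s₁ s₂ D,
    fun n => (length_goodAdv_le n).trans (Nat.mul_le_mul_right _ (by omega)),
    advisedMAGame_goodLang chk hpad hones (fun y => hred _ y) hg' (fun n => hs.id_le n), ?_⟩
  -- the hardness half of Theorem 3.1 for `hardLang`, as in `h31_of_hardLang_protocol_kannanScaled`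
  have hsn : ∀ n, n ≤ s n := fun n => hs.id_le n
  have hAD : A + 1 ≤ D := by omega
  have h2D : 2 ≤ D := by omega
  have hs₂ : ∀ᶠ n in atTop, n ≤ s₂ n := Eventually.of_forall h₂.1
  have hii' : ∀ᶠ n in atTop, s (s₂ n) + 2 ≤ s₁ n := by
    filter_upwards [hii, hs₂, eventually_ge_atTop 2] with n hn hn₂ h2
    have hx : 2 ≤ s (s₂ n) := h2.trans (hn₂.trans (hsn _))
    have h1 : s (s₂ n) + 2 ≤ s (s₂ n) ^ 2 := by nlinarith
    exact h1.trans ((Nat.pow_le_pow_right (by omega) h2D).trans hn)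
  have hiii' : ∀ᶠ m in atTop, ∀ ℓ < m, q.eval (ℓ + (s m + 2)) ≤ s₁ m := by
    filter_upwards [hiii, eventually_ge_atTop (A + A)] with m hm hmA ℓ hℓ
    have hu : A * 1 ^ A + A ≤ m + s m + 2 := by rw [one_pow, mul_one]; omega
    have h1 : q.eval (ℓ + (s m + 2)) ≤ q.eval (1 * (m + s m + 2)) :=
      TM2Iter.eval_mono q (by omega)
    have h2 := hA 1 (m + s m + 2) le_rfl (by omega) hu
    have h3 : (m + s m + 2) ^ (A + 1) ≤ (m + s m + 2) ^ D := Nat.pow_le_pow_right (by omega) hAD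
    exact h1.trans (h2.trans (h3.trans hm))
  have hH := eventually_lt_circuitSize_hardLang_or (D := fun ℓ S => q.eval (ℓ + S)) hpad hones
    hs₂ hii' hiii' hq (eventually_lt_circuitSize_diag hs hsmall) (s₁ := s₁)
  -- transfer to `L₁ = goodLang`, which agrees with `hardLang` on the good lengths
  have hgoodev : ∀ᶠ n in atTop, GoodLen chk.coins pg.natDegree (pg.eval 1) s s₁ s₂ D n :=
    eventually_goodLen hc' hs (by omega) (by omega) (by omega) h₁.1 h₂.1 hi hiii
  have hgoodev₂ : ∀ᶠ n in atTop, GoodLen chk.coins pg.natDegree (pg.eval 1) s s₁ s₂ D (s₂ n) :=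
    (tendsto_atTop_mono h₂.1 tendsto_id).eventually hgoodev
  filter_upwards [hH, hgoodev, hgoodev₂] with n hn hg1 hg2
  rwa [circuitSize_eq_of_forall_iff (L := goodLang Lstar chk.coins pg.natDegree (pg.eval 1) s s₁ s₂ D)
      (n := n) (fun y hy => mem_goodLang_iff_of_good (hy ▸ hg1)),
    circuitSize_eq_of_forall_iff (L := goodLang Lstar chk.coins pg.natDegree (pg.eval 1) s s₁ s₂ D)
      (n := s₂ n) (fun y hy => mem_goodLang_iff_of_good (hy ▸ hg2))]

end Promise

end MWProtocol

/-! ### Consequences: Lemma 4.1 and the headline `NQP ⊄ ACC⁰` over Theorem 2.2 -/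

section Consequences

open Filter AMPlayer

/-- **Murray–Williams 2018, Lemma 4.1 (a.e. form) from the language of Theorem 2.2 and a generator
of Umans' type**: Theorem 3.1 by `MWProtocol.h31_of_sameLengthChecker`, then
`MurrayWilliams2018_lemma_4_1_ae_of_thm_3_1_universal_of_umansGenerator` (the §4 assembly and the
simulation machine `N` are theorems of the tree). [cite: MurrayWilliams2018, Lemma 4.1, Thm. 2.2 and Thm. 3.1] -/
theorem MurrayWilliams2018_lemma_4_1_ae_of_sameLengthChecker_of_umansGenerator (Lstar : Language Bool)
    (hhard : IsHard PSPACE Lstar) (hpad : ∀ z : List Bool, true :: z ∈ Lstar ↔ z ∈ Lstar)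
    (hones : ∀ b : ℕ, List.replicate b true ∉ Lstar) (R : AlmostAE.DSR Lstar)
    (chk : AlmostAE.SameLengthChecker Lstar) (G : UmansGenerator) : MurrayWilliams2018_lemma_4_1_ae :=
  MurrayWilliams2018_lemma_4_1_ae_of_thm_3_1_universal_of_umansGenerator
    (MWProtocol.h31_of_sameLengthChecker Lstar hhard hpad hones R chk) G

/-- **`NQP ⊄ ACC⁰` from the language of Theorem 2.2 and a generator of Umans' type** (through the
named fact `MurrayWilliams2018_lemma_4_1_ae` and `MurrayWilliams2018_NQP_not_subset_ACC0_of_lemma_4_1_ae`: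
machine `B`, Fact 3.1, Thm. 4.1 are theorems). [cite: MurrayWilliams2018, §1.1, Thm. 2.2, Thm. 3.1, Lemma 4.1 and Thm. 1.3] -/
theorem MurrayWilliams2018_NQP_not_subset_ACC0_of_sameLengthChecker_of_umansGenerator (Lstar : Language Bool)
    (hhard : IsHard PSPACE Lstar) (hpad : ∀ z : List Bool, true :: z ∈ Lstar ↔ z ∈ Lstar)
    (hones : ∀ b : ℕ, List.replicate b true ∉ Lstar) (R : AlmostAE.DSR Lstar)
    (chk : AlmostAE.SameLengthChecker Lstar) (G : UmansGenerator) : MurrayWilliams2018_NQP_not_subset_ACC0 :=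
  MurrayWilliams2018_NQP_not_subset_ACC0_of_lemma_4_1_ae
    (MurrayWilliams2018_lemma_4_1_ae_of_sameLengthChecker_of_umansGenerator Lstar hhard hpad hones R chk G)

/-- **`NQP ⊄ ACC⁰` from the language of Theorem 2.2 and the polylogarithmic-seed advice simulation**
(`hsimQ`, verbatim the hypothesis of
`MurrayWilliams2018_NQP_not_subset_ACC0_of_thm_3_1_universal_of_qsimulation`,
`MurrayWilliams2018HeadlineQP.lean`; the form served by the tree's proved table generator). With this
theorem the headline `MurrayWilliams2018_NQP_not_subset_ACC0` rests on: a `PSPACE`-hard, paddable,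
downward self-reducible, same-length checkable language without all-ones words (Murray–Williams'
Thm. 2.2 = Santhanam 2007 over Trevisan–Vadhan) and `hsimQ`.
[cite: MurrayWilliams2018, §1.1, Thm. 2.2, Thm. 3.1, Lemma 4.1 (proof, §4), §5 and Thm. 1.3] -/
theorem MurrayWilliams2018_NQP_not_subset_ACC0_of_sameLengthChecker_of_qsimulation (Lstar : Language Bool)
    (hhard : IsHard PSPACE Lstar) (hpad : ∀ z : List Bool, true :: z ∈ Lstar ↔ z ∈ Lstar)
    (hones : ∀ b : ℕ, List.replicate b true ∉ Lstar) (R : AlmostAE.DSR Lstar)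
    (chk : AlmostAE.SameLengthChecker Lstar)
    (hsimQ : ∀ Ref : Language Bool, Ref ∈ Classes.P → ∃ k c₀ : ℕ, 1 ≤ k ∧
      ∀ (t m : ℕ → ℕ) (a : ℕ), IsTimeConstructible t → Monotone t → IsTimeConstructible m →
        (∀ᶠ n in atTop, m n ≤ t n) →
        ∀ {L : Language Bool} (V : NVerifier t L) (w : ℕ → ℕ) (adv : ℕ → List Bool)
          (L₁ : Language Bool),
          (∀ᶠ n in atTop, (adv n).length ≤ a * n) → AdvisedMAGame Ref m adv L₁ →
          ∃ N' : Language Bool,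
            (∀ T : ℕ → ℕ, (∀ᶠ n in atTop, 2 ^ (k * (Nat.log 2 (t n) + 2) ^ k) ≤ T n) →
              N' ∈ NTIME T) ∧
            ∀ᶠ n in atTop, ∀ xh : List Bool, xh ∈ L → xh.length = n →
              (∀ y : List Bool, y.length ≤ V.c * t xh.length + V.c → V.rel xh y = true →
                w xh.length < stringCC y) →
              ∀ ℓ : ℕ, n ≤ ℓ → (ℓ + m ℓ) ^ k ≤ w n → DecidesOnWithAdvice N' (c₀ * (a + 1)) L₁ ℓ) :
    MurrayWilliams2018_NQP_not_subset_ACC0 :=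
  MurrayWilliams2018_NQP_not_subset_ACC0_of_thm_3_1_universal_of_qsimulation
    (MWProtocol.h31_of_sameLengthChecker Lstar hhard hpad hones R chk) hsimQ

end Consequences

end Literature.Computability.Complexity

end
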